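import Summits.MatrixMultiplication.OmegaCensus.STPPVosperSlackTwoCheckersT
import Summits.MatrixMultiplication.OmegaCensus.STPPVosperSlackTwoTablesZ59
import Summits.MatrixMultiplication.OmegaCensus.STPPVosperSlackTwoLawABQ

/-!
# ω-census (abelian STPP census): ℤ₅₉ leaf L1 = {(2,2,2),(3,3,3)²} — slack-2 three-block law, case A (= B′ by symmetry) rows up to dihedral symmetry, part 1 of 1 (kernel computations)

HONEST FRAMING (pub-omega census; verbatim): lottery ticket; floor = certified bounds/negative ranges.
Census STRUCTURE (seat pub-omega-stpp-2 gen 27 — rows service for the stpp-1 lineage's law, 2026-08-29), family (b2).  Rows for stpp-1 g33's three-block slack-2 law (checker `caseADeadT` of `STPPVosperSlackTwoCheckersT.lean`, dead table `tblZ59L1A` of `…TablesZ59.lean`; block i = a (3,3,3) block read (a,b,c) = (3,3,3), others (2,2,2),(3,3,3), L = z = 13): `dihedralSmaller 59 Q || caseADeadT 59 3 3 13 13 Q tblZ59L1A` over the 1 653 three-shapes `qShapes 59 3` (290 dihedral representatives; mirror 28 630 nodes — stpp-1 g33 s2w_mirror.py ×1, my farm probe of the heaviest three-block shape 26 s).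
Each theorem is ONE `decide +kernel` over one chunk (sized by a python cost mirror to stay under the default-heartbeat ceiling).
Assembly in `STPPVosperSlackTwoRows59L1AAsm.lean`.  Nothing here is progress on `ω`.
-/

namespace Summit.MatrixMultiplication.OmegaCensus.CubeNB.S2

/-- Rows chunk `[0, 1165)`: every entry passes the kernel test. [folklore] -/
theorem rows59L1A_c0 : ((qShapes 59 3 0 1165).all fun Q => dihedralSmaller 59 Q || caseADeadT 59 3 3 13 13 Q tblZ59L1A) = true := by
  decide +kernel

/-- Rows chunk `[1165, 1372)`: every entry passes the kernel test. [folklore] -/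
theorem rows59L1A_c1 : ((qShapes 59 3 1165 1372).all fun Q => dihedralSmaller 59 Q || caseADeadT 59 3 3 13 13 Q tblZ59L1A) = true := by
  decide +kernel

/-- Rows chunk `[1372, 1526)`: every entry passes the kernel test. [folklore] -/
theorem rows59L1A_c2 : ((qShapes 59 3 1372 1526).all fun Q => dihedralSmaller 59 Q || caseADeadT 59 3 3 13 13 Q tblZ59L1A) = true := by
  decide +kernel

/-- Rows chunk `[1526, 1653)`: every entry passes the kernel test. [folklore] -/
theorem rows59L1A_c3 : ((qShapes 59 3 1526 1653).all fun Q => dihedralSmaller 59 Q || caseADeadT 59 3 3 13 13 Q tblZ59L1A) = true := by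
  decide +kernel

end Summit.MatrixMultiplication.OmegaCensus.CubeNB.S2
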